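import Mathlib
import Summits.Ventures.PercRepro2.ZMeanProof
import Summits.Ventures.PercRepro2.PendantRoot
import Summits.Ventures.PercRepro2.PocketTransport
import Summits.Ventures.PercRepro2.PocketBHK
import Summits.Ventures.PercRepro2.PocketMasses
import Summits.Ventures.PercRepro2.HarrisRows
import Summits.Ventures.PercRepro2.StarGlue
import Summits.Ventures.PercRepro2.StarOAlgebra
import Summits.Ventures.PercRepro2.StarOEvents
import Summits.Ventures.PercRepro2.StarOProb
import Summits.Ventures.PercRepro2.StarOMassesA
import Summits.Ventures.PercRepro2.StarOMassesBC
import Summits.Ventures.PercRepro2.StarOXhatA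
import Summits.Ventures.PercRepro2.StarOXhatB
import Summits.Ventures.PercRepro2.StarOEvAlgMain

/-!
# (HMF), hence (HCOV), when `a₃` is adjacent only to `a₁`, `a₂` and `o` (blind cell PercRepro2,
night-1 g8; NIGHT1-G8.md §1, §4)

The masses of `HMFc` at the three-coin star are the expressions `zMass, dMass, …` of
`StarOAlgebra` in the table of the star-zeroed weights `pOut` (`HMFc_star_o`); the table satisfies
the six slack inequalities (cross-cluster BHK `bhk_cross_gshare`, functional same-cluster BHK
`bhk_same_gshare`, the row-wise Harris `Eprod'_le`), so `classO_hmfc_nonneg` gives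
`0 ≤ Z₁ · HMFc`; when `Z₁ = 0` every mass vanishes.  Hence **`HMF_star_o`** and `HCov_star_o`:
the first (HMF) class with an edge from `a₃` to a vertex outside `{a₁, a₂}` that is not in a root-only
pocket (the pocket boundary of NIGHT1-G7 §7′ crossed at `o`).
-/

namespace Summit.Ventures.PercRepro2

open StarGlue PendantRoot UnionCluster

namespace StarO

section Main

variable {V : Type*} {E : Type*} [Fintype E] [DecidableEq E] [Fintype V] [DecidableEq V]
  {R : Type*} [Field R] [LinearOrder R] [IsStrictOrderedRing R]

variable (p : E → R) (ends : E → Sym2 V) {f₁ f₂ f₃ : E} {a₃ a₁ a₂ o b : V}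

/-- **The masses of `HMFc` at the three-coin star are the class-O expressions.** -/
theorem HMFc_star_o (hf₁ : ends f₁ = s(a₃, a₁)) (hf₂ : ends f₂ = s(a₃, a₂))
    (hf₃ : ends f₃ = s(a₃, o)) (hstar : ∀ e, a₃ ∈ ends e → e = f₁ ∨ e = f₂ ∨ e = f₃)
    (h31 : a₃ ≠ a₁) (h32 : a₃ ≠ a₂) (h3o : a₃ ≠ o) (h3b : a₃ ≠ b) (h12 : a₁ ≠ a₂) (h1o : a₁ ≠ o)
    (h2o : a₂ ≠ o) :
    HMFc p ends o a₁ a₂ a₃ b =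
      hmfcMass (prob (pOut p ends a₃) (avoidAll ends a₂ {a₁}))
        (prob (pOut p ends a₃) (avoidAll ends a₂ {a₁} ∩ connEvent ends a₁ o))
        (prob (pOut p ends a₃) (avoidAll ends a₂ {a₁} ∩ connEvent ends a₂ o))
        (prob (pOut p ends a₃) (avoidAll ends a₂ {a₁} ∩ connEvent ends a₁ b))
        (prob (pOut p ends a₃) (avoidAll ends a₂ {a₁} ∩ connEvent ends a₂ b))
        (prob (pOut p ends a₃) (avoidAll ends a₂ {a₁} ∩ connEvent ends a₁ o ∩ connEvent ends a₂ b))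
        (prob (pOut p ends a₃) (avoidAll ends a₂ {a₁} ∩ connEvent ends a₁ o ∩ connEvent ends a₁ b))
        (prob (pOut p ends a₃) (avoidAll ends a₂ {a₁} ∩ connEvent ends a₂ o ∩ connEvent ends a₁ b))
        (prob (pOut p ends a₃) (avoidAll ends a₂ {a₁} ∩ connEvent ends a₂ o ∩ connEvent ends a₂ b))
        (prob (pOut p ends a₃) (avoidAll ends a₂ {a₁} ∩ (connEvent ends o a₁)ᶜ ∩
          (connEvent ends o a₂)ᶜ ∩ connEvent ends a₂ b))
        (cobMass (pOut p ends a₃) ends o a₁ a₂ b)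
        (PocketConn.Eprod' (pOut p ends a₃) ends o a₁ a₂ b)
        (PocketConn.Eprod' (pOut p ends a₃) ends o a₂ a₁ b)
        (termW p ends o a₁ a₂ b {a₃}) (p f₁) (p f₂) (p f₃) := by
  obtain ⟨hf12, hf13, hf23⟩ := star_edges_ne ends hf₁ hf₂ hf₃ h12 h1o h2o h31 h32
  have hstar' : ∀ e, a₃ ∈ ends e → e = f₂ ∨ e = f₁ ∨ e = f₃ := fun e he => by
    rcases hstar e he with h | h | h
    · exact Or.inr (Or.inl h)
    · exact Or.inl h
    · exact Or.inr (Or.inr h)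
  set q := pOut p ends a₃ with hq
  -- the table
  set Z1 := prob q (avoidAll ends a₂ {a₁}) with hZ1
  set AL := prob q (avoidAll ends a₂ {a₁} ∩ connEvent ends a₁ o) with hAL
  set AH := prob q (avoidAll ends a₂ {a₁} ∩ connEvent ends a₂ o) with hAH
  set BL := prob q (avoidAll ends a₂ {a₁} ∩ connEvent ends a₁ b) with hBL
  set BH := prob q (avoidAll ends a₂ {a₁} ∩ connEvent ends a₂ b) with hBH
  set PLH := prob q (avoidAll ends a₂ {a₁} ∩ connEvent ends a₁ o ∩ connEvent ends a₂ b) with hPLH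
  set PLL := prob q (avoidAll ends a₂ {a₁} ∩ connEvent ends a₁ o ∩ connEvent ends a₁ b) with hPLL
  set PHL := prob q (avoidAll ends a₂ {a₁} ∩ connEvent ends a₂ o ∩ connEvent ends a₁ b) with hPHL
  set PHH := prob q (avoidAll ends a₂ {a₁} ∩ connEvent ends a₂ o ∩ connEvent ends a₂ b) with hPHH
  set PNH := prob q (avoidAll ends a₂ {a₁} ∩ (connEvent ends o a₁)ᶜ ∩ (connEvent ends o a₂)ᶜ ∩
    connEvent ends a₂ b) with hPNH
  set cob := cobMass q ends o a₁ a₂ b with hcob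
  set Gob := PocketConn.Eprod' q ends o a₁ a₂ b with hGob
  set Gpob := PocketConn.Eprod' q ends o a₂ a₁ b with hGpob
  -- the masses
  have mQ := prob_Q_star p ends hf₁ hf₂ hf₃ hstar h31 h32 h3o hf12 hf13 hf23
  have mD := prob_PD_star p ends hf₁ hf₂ hf₃ hstar h31 h32 h3o hf12 hf13 hf23
  rw [prob_Q_oN q ends o a₁ a₂] at mD
  have mDoL := prob_PD_inter_conn_star p ends hf₁ hf₂ hf₃ hstar h31 h32 h3o hf12 hf13 hf23
    (x := a₁) (y := o) h31.symm h3o.symm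
  rw [prob_Q_oN_oL_zero q ends o a₁ a₂, mul_zero, add_zero] at mDoL
  have mDoH := prob_PD_inter_conn_star p ends hf₁ hf₂ hf₃ hstar h31 h32 h3o hf12 hf13 hf23
    (x := a₂) (y := o) h32.symm h3o.symm
  rw [prob_Q_oN_oH_zero q ends o a₁ a₂, mul_zero, add_zero] at mDoH
  have mM2 := prob_PD_inter_conn_star p ends hf₁ hf₂ hf₃ hstar h31 h32 h3o hf12 hf13 hf23
    (x := a₂) (y := b) h32.symm h3b.symm
  -- T masses
  have mTbH := prob_T_inter_conn_star p ends hf₁ hf₂ hf₃ hstar h31 h32 h3o hf12 hf13 hf23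
    (x := a₂) (y := b) h32.symm h3b.symm
  rw [glue23_a2 ends o a₂ b, prob_Q_not_oL_bH_union q ends o a₁ a₂ b] at mTbH
  have mTbL := prob_T_inter_conn_star p ends hf₁ hf₂ hf₃ hstar h31 h32 h3o hf12 hf13 hf23
    (x := a₁) (y := b) h31.symm h3b.symm
  rw [Q_glue23_a1 ends o a₁ a₂ b, prob_Q_not_oL q ends o a₁ a₂ (connEvent ends a₁ b)] at mTbL
  have mT := prob_T_inter_conn_star p ends hf₁ hf₂ hf₃ hstar h31 h32 h3o hf12 hf13 hf23
    (x := a₂) (y := a₂) h32.symm h32.symm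
  rw [glue23_a2 ends o a₂ a₂, connEvent_self ends a₂, Set.univ_union, Set.inter_univ, Set.inter_univ,
    Set.inter_univ, Set.inter_univ, prob_Q_not_oL_univ ends q] at mT
  have mToL := prob_T_inter_conn_star p ends hf₁ hf₂ hf₃ hstar h31 h32 h3o hf12 hf13 hf23
    (x := a₁) (y := o) h31.symm h3o.symm
  rw [Q_glue23_a1 ends o a₁ a₂ o, prob_Q_not_oL q ends o a₁ a₂ (connEvent ends a₁ o),
    inter_conn_self, sub_self, mul_zero, add_zero, Q_oH_oL_empty (o := o) (a₁ := a₁) (a₂ := a₂) ends, prob_empty, mul_zero,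
    add_zero] at mToL
  have mToH := prob_T_inter_conn_star p ends hf₁ hf₂ hf₃ hstar h31 h32 h3o hf12 hf13 hf23
    (x := a₂) (y := o) h32.symm h3o.symm
  rw [glue23_a2 ends o a₂ o, connEvent_self ends o, Set.union_univ, Set.inter_univ,
    prob_Q_not_oL_univ ends q, inter_conn_self] at mToH
  -- T′ masses (roots swapped)
  have mTpoL := prob_T_inter_conn_star p ends (f₁ := f₂) (f₂ := f₁) (a₁ := a₂) (a₂ := a₁) hf₂ hf₁ hf₃
    hstar' h32 h31 h3o hf12.symm hf23 hf13 (x := a₁) (y := o) h31.symm h3o.symm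
  rw [avoidAll_swap, glue23_eq_glue13, connEvent_comm ends o a₂, glue13_a1 ends o a₁ o,
    connEvent_self ends o, Set.union_univ, Set.inter_univ, prob_Q_not_oH_univ ends q,
    inter_conn_self] at mTpoL
  have mTpoH := prob_T_inter_conn_star p ends (f₁ := f₂) (f₂ := f₁) (a₁ := a₂) (a₂ := a₁) hf₂ hf₁ hf₃
    hstar' h32 h31 h3o hf12.symm hf23 hf13 (x := a₂) (y := o) h32.symm h3o.symm
  rw [avoidAll_swap, glue23_eq_glue13, connEvent_comm ends o a₂, Q_glue13_a2 ends o a₁ a₂ o,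
    prob_Q_not_oH q ends o a₁ a₂ (connEvent ends a₂ o), inter_conn_self, sub_self, mul_zero,
    add_zero, Q_oL_oH_empty ends o a₁ a₂, prob_empty, mul_zero, add_zero] at mTpoH
  have mTp := prob_T_inter_conn_star p ends (f₁ := f₂) (f₂ := f₁) (a₁ := a₂) (a₂ := a₁) hf₂ hf₁ hf₃
    hstar' h32 h31 h3o hf12.symm hf23 hf13 (x := a₁) (y := a₁) h31.symm h31.symm
  rw [avoidAll_swap, glue23_eq_glue13, connEvent_comm ends o a₂, glue13_a1 ends o a₁ a₁,
    connEvent_self ends a₁, Set.univ_union, Set.inter_univ, Set.inter_univ, Set.inter_univ,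
    Set.inter_univ, prob_Q_not_oH_univ ends q] at mTp
  -- Q masses with a connection
  have mQoL := prob_Q_inter_conn_star p ends hf₁ hf₂ hf₃ hstar h31 h32 h3o hf12 hf13 hf23
    (x := a₁) (y := o) h31.symm h3o.symm
  rw [glue13_a1 ends o a₁ o, connEvent_self ends o, Set.union_univ, Set.inter_univ,
    prob_Q_not_oH_univ ends q, Q_glue23_a1 ends o a₁ a₂ o,
    prob_Q_not_oL q ends o a₁ a₂ (connEvent ends a₁ o), inter_conn_self, sub_self, mul_zero,
    add_zero] at mQoL
  have mQoH := prob_Q_inter_conn_star p ends hf₁ hf₂ hf₃ hstar h31 h32 h3o hf12 hf13 hf23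
    (x := a₂) (y := o) h32.symm h3o.symm
  rw [Q_glue13_a2 ends o a₁ a₂ o, prob_Q_not_oH q ends o a₁ a₂ (connEvent ends a₂ o),
    inter_conn_self, sub_self, mul_zero, add_zero, glue23_a2 ends o a₂ o, connEvent_self ends o,
    Set.union_univ, Set.inter_univ, prob_Q_not_oL_univ ends q] at mQoH
  have mQbH := prob_Q_inter_conn_star p ends hf₁ hf₂ hf₃ hstar h31 h32 h3o hf12 hf13 hf23
    (x := a₂) (y := b) h32.symm h3b.symm
  rw [Q_glue13_a2 ends o a₁ a₂ b, prob_Q_not_oH q ends o a₁ a₂ (connEvent ends a₂ b),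
    glue23_a2 ends o a₂ b, prob_Q_not_oL_bH_union q ends o a₁ a₂ b] at mQbH
  have mQbL := prob_Q_inter_conn_star p ends hf₁ hf₂ hf₃ hstar h31 h32 h3o hf12 hf13 hf23
    (x := a₁) (y := b) h31.symm h3b.symm
  rw [glue13_a1 ends o a₁ b, prob_Q_not_oH_bL_union q ends o a₁ a₂ b, Q_glue23_a1 ends o a₁ a₂ b,
    prob_Q_not_oL q ends o a₁ a₂ (connEvent ends a₁ b)] at mQbL
  -- the mean field
  have mX := Xhat_star3 p ends hf₁ hf₂ hf₃ hstar h31 h32 h3o h3b hf12 hf13 hf23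
  have hheavy : heavySum ends q o a₁ a₂ b = PLH - Gob := by
    unfold heavySum
    rw [PocketConn.sum_T_eq_expect q ends o a₁ a₂ b, PocketConn.expect_FT]
    congr 2
    ext ω
    simp only [Set.mem_inter_iff, mem_connEvent, Set.mem_compl_iff, avoidAll_eq_compl]
    constructor
    · rintro ⟨⟨h2b, h1o⟩, hQ⟩; exact ⟨⟨fun h => hQ (conn_symm h), h1o⟩, h2b⟩
    · rintro ⟨⟨hQ, h1o⟩, h2b⟩; exact ⟨⟨h2b, h1o⟩, fun h => hQ (conn_symm h)⟩
  have hlight : lightSum ends q o a₁ a₂ b = PHL - Gpob := by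
    unfold lightSum
    rw [PocketConn.sum_T_eq_expect q ends o a₂ a₁ b, PocketConn.expect_FT]
    congr 2
    ext ω
    simp only [Set.mem_inter_iff, mem_connEvent, Set.mem_compl_iff, avoidAll_eq_compl]
    constructor
    · rintro ⟨⟨h1b, h2o⟩, hQ⟩; exact ⟨⟨hQ, h2o⟩, h1b⟩
    · rintro ⟨⟨hQ, h2o⟩, h1b⟩; exact ⟨⟨h1b, h2o⟩, hQ⟩
  -- assemble
  have eT1 : connEvent ends a₂ b ∩ TEvent ends a₁ a₂ a₃ = TEvent ends a₁ a₂ a₃ ∩ connEvent ends a₂ b :=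
    Set.inter_comm _ _
  have eT2 : connEvent ends a₁ b ∩ TEvent ends a₁ a₂ a₃ = TEvent ends a₁ a₂ a₃ ∩ connEvent ends a₁ b :=
    Set.inter_comm _ _
  have egap := PocketConn.gap_eq_on_Q p ends a₁ a₂ b
  rw [← avoidAll_eq_compl] at egap
  unfold HMFc CovForm.marginC CovForm.DEF CovForm.EQo CovForm.EQ3 CovForm.EQ3o CovForm.Do massM2 deltaT
  rw [eT1, eT2, egap]
  rw [mQ]
  rw [mD]
  rw [mDoL, mDoH]
  rw [mM2]
  rw [mTbH, mTbL]
  rw [mT]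
  rw [mToL, mToH]
  rw [mTp]
  rw [mTpoL, mTpoH]
  rw [mQoL, mQoH]
  rw [mQbH, mQbL]
  rw [mX, hheavy, hlight]
  unfold hmfcMass zMass dMass doMass wMass eq3Mass eq3oMass eqoMass gapMass xhatMass
  ring

/-- **(HMF) when `a₃` is adjacent only to `a₁`, `a₂` and `o`.** -/
theorem HMF_star_o (hp : IsProbVec p) (hf₁ : ends f₁ = s(a₃, a₁)) (hf₂ : ends f₂ = s(a₃, a₂))
    (hf₃ : ends f₃ = s(a₃, o)) (hstar : ∀ e, a₃ ∈ ends e → e = f₁ ∨ e = f₂ ∨ e = f₃)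
    (h31 : a₃ ≠ a₁) (h32 : a₃ ≠ a₂) (h3o : a₃ ≠ o) (h3b : a₃ ≠ b) (h12 : a₁ ≠ a₂) (h1o : a₁ ≠ o)
    (h2o : a₂ ≠ o) : HMF p ends o a₁ a₂ a₃ b := by
  unfold HMF
  rw [HMFc_star_o p ends hf₁ hf₂ hf₃ hstar h31 h32 h3o h3b h12 h1o h2o]
  set q := pOut p ends a₃ with hq
  have hqp : IsProbVec q := PocketConn.IsProbVec.zeroOn hp _
  have sBH := prob_Q_split_o (o := o) (a₁ := a₁) (a₂ := a₂) ends q (connEvent ends a₂ b)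
  have sBL := prob_Q_split_o (o := o) (a₁ := a₁) (a₂ := a₂) ends q (connEvent ends a₁ b)
  rw [sBH, sBL]
  by_cases hZ : prob q (avoidAll ends a₂ {a₁}) = 0
  · -- every mass vanishes
    have hle : ∀ X, prob q (avoidAll ends a₂ {a₁} ∩ X) = 0 := fun X =>
      le_antisymm (hZ ▸ prob_mono hqp Set.inter_subset_left) (prob_nonneg hqp _)
    have hcob : cobMass q ends o a₁ a₂ b = 0 := by
      unfold cobMass
      exact le_antisymm (hZ ▸ prob_mono hqp (by
        intro ω hω; exact hω.1.1.1.1.1)) (prob_nonneg hqp _)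
    have hG : PocketConn.Eprod' q ends o a₁ a₂ b = 0 := by
      have h1 := PocketConn.Eprod'_le q ends hqp o a₁ a₂ b
      have h2 : 0 ≤ PocketConn.Eprod' q ends o a₁ a₂ b := by
        unfold PocketConn.Eprod'
        refine expect_nonneg hqp fun ω => ?_
        refine mul_nonneg (mul_nonneg ?_ ?_) (Set.indicator_nonneg (fun _ _ => zero_le_one) _)
        · exact prob_nonneg hqp _
        · exact prob_nonneg hqp _
      have h3 : prob q (connEvent ends a₁ o ∩ connEvent ends a₁ b ∩ (connEvent ends a₂ a₁)ᶜ) = 0 := by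
        refine le_antisymm (hZ ▸ prob_mono hqp ?_) (prob_nonneg hqp _)
        rintro ω ⟨_, hQ⟩
        rw [avoidAll_eq_compl]
        exact fun h => hQ (conn_symm h)
      linarith
    have hG' : PocketConn.Eprod' q ends o a₂ a₁ b = 0 := by
      have h1 := PocketConn.Eprod'_le q ends hqp o a₂ a₁ b
      have h2 : 0 ≤ PocketConn.Eprod' q ends o a₂ a₁ b := by
        unfold PocketConn.Eprod'
        refine expect_nonneg hqp fun ω => ?_
        refine mul_nonneg (mul_nonneg ?_ ?_) (Set.indicator_nonneg (fun _ _ => zero_le_one) _)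
        · exact prob_nonneg hqp _
        · exact prob_nonneg hqp _
      have h3 : prob q (connEvent ends a₂ o ∩ connEvent ends a₂ b ∩ (connEvent ends a₁ a₂)ᶜ) = 0 := by
        refine le_antisymm (hZ ▸ prob_mono hqp ?_) (prob_nonneg hqp _)
        rintro ω ⟨_, hQ⟩
        rw [avoidAll_eq_compl]
        exact hQ
      linarith
    simp only [hle, hZ, hcob, hG, hG', hmfcMass, zMass, dMass, doMass, wMass, eq3Mass, eq3oMass,
      eqoMass, gapMass, xhatMass]
    ring_nf
    exact le_refl _
  · have hZpos : 0 < prob q (avoidAll ends a₂ {a₁}) :=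
      lt_of_le_of_ne (prob_nonneg hqp _) (Ne.symm hZ)
    -- the events of the BHK / Harris lemmas in the table's form
    have eQ : (connEvent ends a₂ a₁)ᶜ = avoidAll ends a₂ {a₁} := by
      rw [avoidAll_eq_compl, connEvent_comm]
    have eQ' : (connEvent ends a₁ a₂)ᶜ = avoidAll ends a₂ {a₁} := (avoidAll_eq_compl _ _ _).symm
    have eXQ : ∀ X : Set (Config E), X ∩ avoidAll ends a₂ {a₁} = avoidAll ends a₂ {a₁} ∩ X :=
      fun X => Set.inter_comm _ _
    have eXYQ : ∀ X Y : Set (Config E), X ∩ Y ∩ avoidAll ends a₂ {a₁} =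
        avoidAll ends a₂ {a₁} ∩ Y ∩ X := by
      intro X Y; ext ω; simp only [Set.mem_inter_iff]; tauto
    have hsLH : 0 ≤ prob q (avoidAll ends a₂ {a₁} ∩ connEvent ends a₁ o) *
        prob q (avoidAll ends a₂ {a₁} ∩ connEvent ends a₂ b) -
        prob q (avoidAll ends a₂ {a₁}) *
          prob q (avoidAll ends a₂ {a₁} ∩ connEvent ends a₁ o ∩ connEvent ends a₂ b) := by
      have h := PocketConn.bhk_cross_gshare q ends hqp o a₁ a₂ b
      rw [eQ, eXYQ, eXQ, eXQ] at h
      linarith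
    have hsHL : 0 ≤ prob q (avoidAll ends a₂ {a₁} ∩ connEvent ends a₂ o) *
        prob q (avoidAll ends a₂ {a₁} ∩ connEvent ends a₁ b) -
        prob q (avoidAll ends a₂ {a₁}) *
          prob q (avoidAll ends a₂ {a₁} ∩ connEvent ends a₂ o ∩ connEvent ends a₁ b) := by
      have h := PocketConn.bhk_cross_gshare q ends hqp o a₂ a₁ b
      rw [eQ', eXYQ, eXQ, eXQ] at h
      linarith
    have huLL : 0 ≤ prob q (avoidAll ends a₂ {a₁}) * PocketConn.Eprod' q ends o a₁ a₂ b -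
        prob q (avoidAll ends a₂ {a₁} ∩ connEvent ends a₁ o) *
          prob q (avoidAll ends a₂ {a₁} ∩ connEvent ends a₁ b) := by
      have h := PocketConn.bhk_same_gshare q ends hqp o a₁ a₂ b
      rw [eQ, eXQ, eXQ] at h
      linarith
    have huHH : 0 ≤ prob q (avoidAll ends a₂ {a₁}) * PocketConn.Eprod' q ends o a₂ a₁ b -
        prob q (avoidAll ends a₂ {a₁} ∩ connEvent ends a₂ o) *
          prob q (avoidAll ends a₂ {a₁} ∩ connEvent ends a₂ b) := by
      have h := PocketConn.bhk_same_gshare q ends hqp o a₂ a₁ b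
      rw [eQ', eXQ, eXQ] at h
      linarith
    have hhLL : 0 ≤ prob q (avoidAll ends a₂ {a₁} ∩ connEvent ends a₁ o ∩ connEvent ends a₁ b) -
        PocketConn.Eprod' q ends o a₁ a₂ b := by
      have h := PocketConn.Eprod'_le q ends hqp o a₁ a₂ b
      rw [eQ, eXYQ] at h
      have e : avoidAll ends a₂ {a₁} ∩ connEvent ends a₁ b ∩ connEvent ends a₁ o =
          avoidAll ends a₂ {a₁} ∩ connEvent ends a₁ o ∩ connEvent ends a₁ b := by
        rw [Set.inter_right_comm]
      rw [e] at h
      linarith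
    have hhHH : 0 ≤ prob q (avoidAll ends a₂ {a₁} ∩ connEvent ends a₂ o ∩ connEvent ends a₂ b) -
        PocketConn.Eprod' q ends o a₂ a₁ b := by
      have h := PocketConn.Eprod'_le q ends hqp o a₂ a₁ b
      rw [eQ', eXYQ] at h
      have e : avoidAll ends a₂ {a₁} ∩ connEvent ends a₂ b ∩ connEvent ends a₂ o =
          avoidAll ends a₂ {a₁} ∩ connEvent ends a₂ o ∩ connEvent ends a₂ b := by
        rw [Set.inter_right_comm]
      rw [e] at h
      linarith
    have hAN : prob q (avoidAll ends a₂ {a₁} ∩ connEvent ends a₁ o) +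
        prob q (avoidAll ends a₂ {a₁} ∩ connEvent ends a₂ o) ≤ prob q (avoidAll ends a₂ {a₁}) := by
      have h := prob_Q_split_o (o := o) (a₁ := a₁) (a₂ := a₂) ends q Set.univ
      simp only [Set.inter_univ] at h
      have := prob_nonneg hqp (avoidAll ends a₂ {a₁} ∩ (connEvent ends o a₁)ᶜ ∩ (connEvent ends o a₂)ᶜ)
      linarith
    have hX0 := termW_singleton_eq p ends h31 h32 h3o h3b hZ
    rw [sBH, sBL] at hX0
    rw [sBH] at hsLH huHH
    rw [sBL] at hsHL huLL
    have hcob0 : 0 ≤ cobMass q ends o a₁ a₂ b := by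
      unfold cobMass; exact prob_nonneg hqp _
    have key := classO_hmfc_nonneg (R := R) (cob := cobMass q ends o a₁ a₂ b) hX0
      (prob_nonneg hqp _) (prob_nonneg hqp _) (prob_nonneg hqp _) hAN hcob0 hsLH hsHL huLL huHH
      hhLL hhHH (hp.nonneg f₁) (hp.le_one f₁) (hp.nonneg f₂) (hp.le_one f₂) (hp.nonneg f₃)
      (hp.le_one f₃)
    exact (mul_nonneg_iff_of_pos_left hZpos).1 key

/-- **(HCOV) when `a₃` is adjacent only to `a₁`, `a₂` and `o`.** -/
theorem HCov_star_o (hp : IsProbVec p) (hf₁ : ends f₁ = s(a₃, a₁)) (hf₂ : ends f₂ = s(a₃, a₂))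
    (hf₃ : ends f₃ = s(a₃, o)) (hstar : ∀ e, a₃ ∈ ends e → e = f₁ ∨ e = f₂ ∨ e = f₃)
    (h31 : a₃ ≠ a₁) (h32 : a₃ ≠ a₂) (h3o : a₃ ≠ o) (h3b : a₃ ≠ b) (h12 : a₁ ≠ a₂) (h1o : a₁ ≠ o)
    (h2o : a₂ ≠ o) : CovForm.HCov p ends o a₁ a₂ a₃ b :=
  HCov_of_HMF p hp ends o a₁ a₂ a₃ b (HMF_star_o p ends hp hf₁ hf₂ hf₃ hstar h31 h32 h3o h3b h12 h1o h2o)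

end Main

end StarO

end Summit.Ventures.PercRepro2
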